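import Mathlib
import Literature.Probability.Percolation.DiagonalStripLumping
import Literature.Probability.Percolation.DiagonalStripTransferExplicit
import Literature.Probability.Percolation.DiagonalStripTransferInsertion
import Literature.Probability.Percolation.DiagonalStripJunction
import HarnessLib

/-!
# Wiring the level-`1` edges of the two-layer transfer matrix

Topic `Literature/Probability/Percolation`. Combinatorics of the two lattice edges of top level `1`
in IP12's two-layer transfer matrix `t = lump ∘ F₁ ∘ F₀` (Ikhlef–Ponsaing, J. Stat. Phys. 149 (2012),
arXiv:1202.5476, §3.1): `levelOneEdge₀` joins the old bottom (wall) site to the new odd site `0`,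
`levelOneEdge₁` joins the odd site `0` to the new bottom (wall) site. Since both endpoints on the
even columns touch the wall, opening either edge has the same effect on the LUMPED outcome — it
wires the odd site `0` to the wall (`wire0`): **`twoStep_insert₀_eq_insert₁`**,
**`twoStep_insert₀_insert₁`** (for valid lumped input patterns). With both edges closed, a
wall-disconnected pattern (`¬ WallConn`: no site other than the bottom one touches the wall) stays
wall-disconnected (**`not_wallConn_twoStep`**), and a junction through the wall at the top site
involves a wall-connected pattern (**`wallConn_or_of_ipJunction`**). These feed the analysis of the
transfer matrix at `z_1 = 0` (`DiagonalStripTransferAtZero`).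

## References

* Y. Ikhlef, A. K. Ponsaing, *Finite-size left-passage probability in percolation*, J. Stat. Phys.
  149 (2012) 10–36, arXiv:1202.5476, §3.1. [IkhlefPonsaing2012]
-/

namespace Literature.Probability.Percolation

open Finset Relation Literature.Probability.LatticeModels

variable {m : ℕ}

section Wiring

/-! ### Generic closure lemmas -/

/-- A point touched by no generator other than loops is alone in its class. [folklore] -/
theorem eqvGen_eq_of_isolated {V : Type*} {r : V → V → Prop} {z : V} (hz : ∀ y, (r z y → y = z) ∧ (r y z → y = z))
    {x y : V} (h : EqvGen r x y) : x = z ↔ y = z := by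
  induction h with
  | rel a b hr =>
    constructor
    · rintro rfl; exact (hz b).1 hr
    · rintro rfl; exact (hz a).2 hr
  | refl a => exact Iff.rfl
  | symm a b _ ih => exact ih.symm
  | trans a b c _ _ ih₁ ih₂ => exact ih₁.trans ih₂

/-- The reversed copy of an added pair is redundant in the closure. [folklore] -/
theorem eqvGen_or_symm_iff {V : Type*} (r : V → V → Prop) (a b x y : V) :
    EqvGen (fun x y => r x y ∨ (x = a ∧ y = b) ∨ (x = b ∧ y = a)) x y ↔
      EqvGen (fun x y => r x y ∨ (x = a ∧ y = b)) x y := by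
  constructor
  · intro h
    induction h with
    | rel u v hr =>
      rcases hr with hr | hr | ⟨rfl, rfl⟩
      · exact EqvGen.rel _ _ (Or.inl hr)
      · exact EqvGen.rel _ _ (Or.inr hr)
      · exact EqvGen.symm _ _ (EqvGen.rel _ _ (Or.inr ⟨rfl, rfl⟩))
    | refl u => exact EqvGen.refl _
    | symm u v _ ih => exact EqvGen.symm _ _ ih
    | trans u v w _ _ ih₁ ih₂ => exact EqvGen.trans _ _ _ ih₁ ih₂
  · exact fun h => EqvGen.mono (fun u v huv => huv.elim Or.inl fun h' => Or.inr (Or.inl h')) _ _ h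

/-! ### Inserting one lattice edge into a layer -/

/-- The edge layer of `insert e U` for the pair `e = {colSite c a, colSite (c+1) b}`. [folklore] -/
theorem edgeFn_insert_or (c : ℤ) (U : Finset (Sym2 (Site 2))) (a b i j : Fin (m + 1)) :
    edgeFn m c (insert s(colSite c a, colSite (c + 1) b) U) i j =
      (edgeFn m c U i j || decide (i = a ∧ j = b)) := by
  unfold edgeFn
  rw [Bool.eq_iff_iff]
  simp only [Finset.mem_insert, decide_eq_true_eq, Bool.or_eq_true]
  constructor
  · rintro (h | h)
    · right
      have := mk_colSite_injective (m := m) c (a₁ := (i, j)) (a₂ := (a, b)) h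
      simp only [Prod.mk.injEq] at this
      exact this
    · exact Or.inl h
  · rintro (h | ⟨rfl, rfl⟩)
    · exact Or.inr h
    · exact Or.inl rfl

/-- The update relation with one more edge. [folklore] -/
theorem updRel_edgeFn_insert (c : ℤ) (P : ColPattern m) (U : Finset (Sym2 (Site 2))) (a b : Fin (m + 1))
    (x y : Fin (m + 1) ⊕ Fin (m + 1)) :
    updRel m P (edgeFn m c (insert s(colSite c a, colSite (c + 1) b) U)) x y ↔
      updRel m P (edgeFn m c U) x y ∨ (x = Sum.inl a ∧ y = Sum.inr b) ∨ (x = Sum.inr b ∧ y = Sum.inl a) := by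
  rcases x with i | j <;> rcases y with i' | j' <;>
    simp only [updRel, edgeFn_insert_or, Bool.or_eq_true, decide_eq_true_eq, Sum.inl.injEq, Sum.inr.injEq,
      reduceCtorEq, and_false, false_and, or_false, false_or]
  · exact or_congr_right (and_comm)

/-- **The closure of the update relation with one more edge** is the merge of the two endpoint
classes. [folklore] -/
theorem eqvGen_updRel_insert (c : ℤ) (P : ColPattern m) (U : Finset (Sym2 (Site 2))) (a b : Fin (m + 1))
    (x y : Fin (m + 1) ⊕ Fin (m + 1)) :
    EqvGen (updRel m P (edgeFn m c (insert s(colSite c a, colSite (c + 1) b) U))) x y ↔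
      mergeRel (EqvGen (updRel m P (edgeFn m c U))) (Sum.inl a) (Sum.inr b) x y := by
  have : updRel m P (edgeFn m c (insert s(colSite c a, colSite (c + 1) b) U)) =
      fun x y => updRel m P (edgeFn m c U) x y ∨ (x = Sum.inl a ∧ y = Sum.inr b) ∨ (x = Sum.inr b ∧ y = Sum.inl a) := by
    funext x y; exact propext (updRel_edgeFn_insert c P U a b x y)
  rw [this, eqvGen_or_symm_iff, eqvGen_insert_iff_mergeRel]

/-! ### Wiring the bottom odd site to the wall -/

/-- **Wiring**: flag the class of site `0` (keep the connections). [folklore] -/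
def wire0 (P : ColPattern m) : ColPattern m := (P.1, fun j => P.2 j || P.1 j 0)

/-- The connections are kept. [folklore] -/
@[simp] theorem wire0_fst (P : ColPattern m) : (wire0 P).1 = P.1 := rfl

/-- The flags of the wired pattern. [folklore] -/
theorem wire0_snd (P : ColPattern m) (j : Fin (m + 1)) : (wire0 P).2 j = (P.2 j || P.1 j 0) := rfl

/-- Wiring is idempotent. [folklore] -/
theorem wire0_wire0 (P : ColPattern m) : wire0 (wire0 P) = wire0 P := by
  refine Prod.ext rfl (funext fun j => ?_)
  simp only [wire0_snd, wire0_fst, Bool.or_assoc, Bool.or_self]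

/-- The update relation does not see the flags. [folklore] -/
theorem updRel_wire0 (P : ColPattern m) (E : Fin (m + 1) → Fin (m + 1) → Bool) :
    updRel m (wire0 P) E = updRel m P E := by
  funext x y; rcases x with i | j <;> rcases y with i' | j' <;> rfl

section Layer0

variable {Q : ColPattern m}

/-- In a valid lumped even pattern every flagged site is joined to the bottom site. [folklore] -/
theorem fst_zero_of_snd (hQ : IsValid 0 Q) (hl : lump Q = Q) {i : Fin (m + 1)} (hi : Q.2 i = true) : Q.1 i 0 = true :=
  (lump_eq_self_iff Q).1 hl i 0 hi (hQ.bottom (by decide))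

/-- **The new flags of the layer-`0` update**: a new (odd) site is flagged iff it is joined to the
old bottom site. [folklore] -/
theorem colUpdate_zero_snd_iff (hQ : IsValid 0 Q) (hl : lump Q = Q) (E : Fin (m + 1) → Fin (m + 1) → Bool)
    (j : Fin (m + 1)) :
    (colUpdate m 0 Q E).2 j = true ↔ EqvGen (updRel m Q E) (Sum.inr j) (Sum.inl 0) := by
  rw [colUpdate_snd_iff]
  constructor
  · rintro ⟨z, hz, hw⟩
    rcases z with i | j'
    · exact EqvGen.trans _ _ _ hz (EqvGen.rel _ _ (show updRel m Q E (Sum.inl i) (Sum.inl 0) from fst_zero_of_snd hQ hl hw))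
    · simp [updWall] at hw
  · intro h
    exact ⟨Sum.inl 0, h, hQ.bottom (by decide)⟩

/-- **Opening the level-`1` edge of layer `0` amounts to wiring the new bottom site** (after
lumping): the edge joins the new site `0` to the old bottom site, which touches the wall.
[cite: IkhlefPonsaing2012, §3.1] -/
theorem lump_colUpdate_zero_insert (hQ : IsValid 0 Q) (hl : lump Q = Q) (U : Finset (Sym2 (Site 2))) :
    lump (colUpdate m 0 Q (edgeFn m 0 (insert s(colSite 0 ((0 : Fin (m + 1)) : ℕ), colSite (0 + 1) ((0 : Fin (m + 1)) : ℕ)) U))) =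
      lump (wire0 (colUpdate m 0 Q (edgeFn m 0 U))) := by
  set E := edgeFn m 0 U
  set E' := edgeFn m 0 (insert s(colSite 0 ((0 : Fin (m + 1)) : ℕ), colSite (0 + 1) ((0 : Fin (m + 1)) : ℕ)) U)
  set S := EqvGen (updRel m Q E) with hS
  have hSe : Equivalence S := EqvGen.is_equivalence _
  have hS' : ∀ x y, EqvGen (updRel m Q E') x y ↔ mergeRel S (Sum.inl 0) (Sum.inr 0) x y :=
    eqvGen_updRel_insert 0 Q U 0 0
  -- the wiring predicate
  set w : Fin (m + 1) → Prop := fun j => S (Sum.inr j) (Sum.inl 0) ∨ S (Sum.inr j) (Sum.inr 0) with hw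
  have hflag : ∀ j, (colUpdate m 0 Q E).2 j = true ↔ S (Sum.inr j) (Sum.inl 0) := colUpdate_zero_snd_iff hQ hl E
  have hwire : ∀ j, (wire0 (colUpdate m 0 Q E)).2 j = true ↔ w j := fun j => by
    rw [wire0_snd, Bool.or_eq_true, hflag, colUpdate_fst_iff]
  have hflag' : ∀ j, (colUpdate m 0 Q E').2 j = true ↔ w j := by
    intro j
    rw [colUpdate_snd_iff]
    constructor
    · rintro ⟨z, hz, hwz⟩
      rw [hS'] at hz
      rcases z with i | j'
      · have hi0 : S (Sum.inl i) (Sum.inl 0) :=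
          EqvGen.rel _ _ (show updRel m Q E (Sum.inl i) (Sum.inl 0) from fst_zero_of_snd hQ hl hwz)
        rcases hz with h | ⟨h, -⟩ | ⟨h, -⟩
        · exact Or.inl (hSe.trans h hi0)
        · exact Or.inl h
        · exact Or.inr h
      · simp [updWall] at hwz
    · rintro (h | h)
      · exact ⟨Sum.inl 0, (hS' _ _).2 (mergeRel_of_rel h), hQ.bottom (by decide)⟩
      · exact ⟨Sum.inl 0, (hS' _ _).2 (Or.inr (Or.inr ⟨h, hSe.refl _⟩)), hQ.bottom (by decide)⟩
  refine Prod.ext (funext fun j => funext fun j' => Bool.eq_iff_iff.2 ?_) (funext fun j => Bool.eq_iff_iff.2 ?_)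
  · rw [lump_fst_eq_true_iff, lump_fst_eq_true_iff, hflag', hflag', hwire, hwire, wire0_fst, colUpdate_fst_iff,
      colUpdate_fst_iff, hS']
    constructor
    · rintro ((h | ⟨h1, h2⟩ | ⟨h1, h2⟩) | h)
      · exact Or.inl h
      · exact Or.inr ⟨Or.inl h1, Or.inr (hSe.symm h2)⟩
      · exact Or.inr ⟨Or.inr h1, Or.inl (hSe.symm h2)⟩
      · exact Or.inr h
    · rintro (h | h)
      · exact Or.inl (mergeRel_of_rel h)
      · exact Or.inr h
  · rw [lump_snd, lump_snd, hflag', hwire]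

end Layer0

section Layer1

variable {P₁ : ColPattern m}

/-- **Opening the level-`1` edge of layer `1` amounts to wiring the old bottom site** (after
lumping): the edge joins the old odd site `0` to the new bottom site, which lies on the wall; no other
edge of the layer touches the new bottom site. [cite: IkhlefPonsaing2012, §3.1] -/
theorem lump_colUpdate_one_insert (hP : ∀ i, P₁.1 i i = true) {U : Finset (Sym2 (Site 2))}
    (hiso : ∀ i, edgeFn m 1 U i 0 = false) :
    lump (colUpdate m 1 P₁ (edgeFn m 1 (insert s(colSite 1 ((0 : Fin (m + 1)) : ℕ), colSite (1 + 1) ((0 : Fin (m + 1)) : ℕ)) U))) =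
      lump (colUpdate m 1 (wire0 P₁) (edgeFn m 1 U)) := by
  set E := edgeFn m 1 U
  set E' := edgeFn m 1 (insert s(colSite 1 ((0 : Fin (m + 1)) : ℕ), colSite (1 + 1) ((0 : Fin (m + 1)) : ℕ)) U)
  set S := EqvGen (updRel m P₁ E) with hS
  have hSe : Equivalence S := EqvGen.is_equivalence _
  have hS' : ∀ x y, EqvGen (updRel m P₁ E') x y ↔ mergeRel S (Sum.inl 0) (Sum.inr 0) x y :=
    eqvGen_updRel_insert 1 P₁ U 0 0
  have hSw : EqvGen (updRel m (wire0 P₁) E) = S := by rw [updRel_wire0]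
  -- the new bottom site is isolated
  have hiso' : ∀ y, (updRel m P₁ E (Sum.inr 0) y → y = Sum.inr 0) ∧ (updRel m P₁ E y (Sum.inr 0) → y = Sum.inr 0) := by
    intro y
    rcases y with i | j <;> simp [updRel, E, hiso]
  have hinr0 : ∀ x, S x (Sum.inr 0) → x = Sum.inr 0 := fun x h => ((eqvGen_eq_of_isolated hiso' h).2 rfl)
  -- old flags and the wiring predicate
  set f : Fin (m + 1) → Prop := fun j => (colUpdate m 1 P₁ E).2 j = true ∨ S (Sum.inr j) (Sum.inl 0) with hf
  have hwall0 : updWall m 1 P₁ (Sum.inr 0) := by simp [updWall]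
  have hf0 : f 0 := Or.inl ((colUpdate_snd_iff 1 P₁ E 0).2 ⟨Sum.inr 0, hSe.refl _, hwall0⟩)
  have hflag' : ∀ j, (colUpdate m 1 P₁ E').2 j = true ↔ f j := by
    intro j
    rw [colUpdate_snd_iff]
    simp only [hf, colUpdate_snd_iff]
    constructor
    · rintro ⟨z, hz, hwz⟩
      rw [hS'] at hz
      rcases hz with h | ⟨h, -⟩ | ⟨h, -⟩
      · exact Or.inl ⟨z, h, hwz⟩
      · exact Or.inr h
      · have := hinr0 _ h
        simp only [Sum.inr.injEq] at this
        subst this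
        exact Or.inl ⟨Sum.inr 0, hSe.refl _, hwall0⟩
    · rintro (⟨z, hz, hwz⟩ | h)
      · exact ⟨z, (hS' _ _).2 (mergeRel_of_rel hz), hwz⟩
      · exact ⟨Sum.inr 0, (hS' _ _).2 (Or.inr (Or.inl ⟨h, hSe.refl _⟩)), hwall0⟩
  have hflagw : ∀ j, (colUpdate m 1 (wire0 P₁) E).2 j = true ↔ f j := by
    intro j
    rw [colUpdate_snd_iff, hSw]
    simp only [hf, colUpdate_snd_iff]
    constructor
    · rintro ⟨z, hz, hwz⟩
      rcases z with i | j'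
      · simp only [updWall, wire0_snd, Bool.or_eq_true] at hwz
        rcases hwz with h | h
        · exact Or.inl ⟨Sum.inl i, hz, h⟩
        · exact Or.inr (hSe.trans hz (EqvGen.rel _ _ (show updRel m P₁ E (Sum.inl i) (Sum.inl 0) from h)))
      · exact Or.inl ⟨Sum.inr j', hz, hwz⟩
    · rintro (⟨z, hz, hwz⟩ | h)
      · refine ⟨z, hz, ?_⟩
        rcases z with i | j'
        · simp only [updWall, wire0_snd, Bool.or_eq_true] at hwz ⊢
          exact Or.inl hwz
        · exact hwz
      · exact ⟨Sum.inl 0, h, by simp [updWall, wire0_snd, hP 0]⟩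
  refine Prod.ext (funext fun j => funext fun j' => Bool.eq_iff_iff.2 ?_) (funext fun j => Bool.eq_iff_iff.2 ?_)
  · rw [lump_fst_eq_true_iff, lump_fst_eq_true_iff, hflag', hflag', hflagw, hflagw, colUpdate_fst_iff,
      colUpdate_fst_iff, hS', hSw]
    constructor
    · rintro ((h | ⟨h1, h2⟩ | ⟨h1, h2⟩) | h)
      · exact Or.inl h
      · have := hinr0 _ (hSe.symm h2)
        simp only [Sum.inr.injEq] at this
        subst this
        exact Or.inr ⟨Or.inr h1, hf0⟩
      · have := hinr0 _ h1
        simp only [Sum.inr.injEq] at this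
        subst this
        exact Or.inr ⟨hf0, Or.inr (hSe.symm h2)⟩
      · exact Or.inr h
    · rintro (h | h)
      · exact Or.inl (mergeRel_of_rel h)
      · exact Or.inr h
  · rw [lump_snd, lump_snd, hflag', hflagw]

end Layer1

section TwoStep

/-- The level-`1` edge of layer `0` (old bottom site — new odd site `0`). [folklore] -/
def levelOneEdge₀ : Sym2 (Site 2) := s(colSite 0 0, colSite (0 + 1) 0)

/-- The level-`1` edge of layer `1` (old odd site `0` — new bottom site). [folklore] -/
def levelOneEdge₁ : Sym2 (Site 2) := s(colSite 1 0, colSite (1 + 1) 0)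

/-- **The lumped two-layer update** `Q ↦ lump (F₁(F₀(Q, 1_{U₀}), 1_{U₁}))`. [cite: IkhlefPonsaing2012, §3.1] -/
noncomputable def twoStep (Q : ColPattern m) (U₀ U₁ : Finset (Sym2 (Site 2))) : ColPattern m :=
  lump (colUpdate m 1 (colUpdate m 0 Q (edgeFn m 0 U₀)) (edgeFn m 1 U₁))

variable {Q : ColPattern m}

/-- **Outcome coincidence I**: opening the level-`1` edge in layer `0` or in layer `1` gives the
same lumped two-layer update. [cite: IkhlefPonsaing2012, §3.1] -/
theorem twoStep_insert₀_eq_insert₁ (hQ : IsValid 0 Q) (hl : lump Q = Q) (U₀ : Finset (Sym2 (Site 2)))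
    {U₁ : Finset (Sym2 (Site 2))} (hiso : ∀ i, edgeFn m 1 U₁ i 0 = false) :
    twoStep Q (insert levelOneEdge₀ U₀) U₁ = twoStep Q U₀ (insert levelOneEdge₁ U₁) := by
  unfold twoStep levelOneEdge₀ levelOneEdge₁
  have ha := lump_colUpdate_zero_insert hQ hl U₀
  simp only [Fin.val_zero] at ha
  rw [← lump_colUpdate_lump 1 (colUpdate m 0 Q _), ha, lump_colUpdate_lump]
  have hb := lump_colUpdate_one_insert (colUpdate_isValid 0 Q (edgeFn m 0 U₀)).refl hiso
  simp only [Fin.val_zero] at hb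
  rw [hb]

/-- **Outcome coincidence II**: opening both level-`1` edges gives the same lumped update as
opening one. [cite: IkhlefPonsaing2012, §3.1] -/
theorem twoStep_insert₀_insert₁ (hQ : IsValid 0 Q) (hl : lump Q = Q) (U₀ : Finset (Sym2 (Site 2)))
    {U₁ : Finset (Sym2 (Site 2))} (hiso : ∀ i, edgeFn m 1 U₁ i 0 = false) :
    twoStep Q (insert levelOneEdge₀ U₀) (insert levelOneEdge₁ U₁) = twoStep Q (insert levelOneEdge₀ U₀) U₁ := by
  unfold twoStep levelOneEdge₀ levelOneEdge₁
  have ha := lump_colUpdate_zero_insert hQ hl U₀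
  simp only [Fin.val_zero] at ha
  rw [← lump_colUpdate_lump 1 (colUpdate m 0 Q _), ha, lump_colUpdate_lump, ← lump_colUpdate_lump 1 (colUpdate m 0 Q _) (edgeFn m 1 U₁),
    ha, lump_colUpdate_lump]
  set P₁ := colUpdate m 0 Q (edgeFn m 0 U₀)
  have hrefl : ∀ i, (wire0 P₁).1 i i = true := (colUpdate_isValid 0 Q (edgeFn m 0 U₀)).refl
  have hb := lump_colUpdate_one_insert hrefl hiso
  simp only [Fin.val_zero] at hb
  rw [hb, wire0_wire0]

/-! ### Wall-connected patterns -/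

/-- A pattern is **wall-connected** when some site other than the bottom one touches the wall.
[cite: IkhlefPonsaing2012, §4.1] -/
def WallConn (Q : ColPattern m) : Prop := ∃ j : Fin (m + 1), j ≠ 0 ∧ Q.2 j = true

/-- Wall-connectedness is decidable. [folklore] -/
instance (Q : ColPattern m) : Decidable (WallConn Q) := by unfold WallConn; infer_instance

/-- **Wall-disconnected patterns stay wall-disconnected** when both level-`1` edges are closed.
[cite: IkhlefPonsaing2012, §3.1] -/
theorem not_wallConn_twoStep (hQ : IsValid 0 Q) (hD : ¬ WallConn Q) {U₀ U₁ : Finset (Sym2 (Site 2))}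
    (hiso₀ : ∀ j, edgeFn m 0 U₀ 0 j = false) (hiso₁ : ∀ i, edgeFn m 1 U₁ i 0 = false) :
    ¬ WallConn (twoStep Q U₀ U₁) := by
  have hflagQ : ∀ i, Q.2 i = true → i = 0 := fun i hi => by
    by_contra hne; exact hD ⟨i, hne, hi⟩
  set P₁ := colUpdate m 0 Q (edgeFn m 0 U₀) with hP₁
  -- the old bottom site is isolated in layer `0`
  have hiso₀' : ∀ y, (updRel m Q (edgeFn m 0 U₀) (Sum.inl 0) y → y = Sum.inl 0) ∧
      (updRel m Q (edgeFn m 0 U₀) y (Sum.inl 0) → y = Sum.inl 0) := by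
    intro y
    rcases y with i | j
    · simp only [updRel, Sum.inl.injEq]
      exact ⟨fun h => hflagQ i (hQ.wall 0 i h (hQ.bottom (by decide))),
        fun h => hflagQ i (hQ.wall 0 i (hQ.symm _ _ h) (hQ.bottom (by decide)))⟩
    · simp [updRel, hiso₀]
  have hP₁flag : ∀ j, P₁.2 j = false := by
    intro j
    rw [Bool.eq_false_iff, ne_eq, colUpdate_snd_iff]
    rintro ⟨z, hz, hw⟩
    rcases z with i | j'
    · have hi : i = 0 := hflagQ i hw
      subst hi
      exact absurd ((eqvGen_eq_of_isolated hiso₀' hz).2 rfl) (by simp)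
    · simp [updWall] at hw
  -- the new bottom site is isolated in layer `1`
  have hiso₁' : ∀ y, (updRel m P₁ (edgeFn m 1 U₁) (Sum.inr 0) y → y = Sum.inr 0) ∧
      (updRel m P₁ (edgeFn m 1 U₁) y (Sum.inr 0) → y = Sum.inr 0) := by
    intro y
    rcases y with i | j <;> simp [updRel, hiso₁]
  rintro ⟨j, hj, hflag⟩
  unfold twoStep at hflag
  rw [lump_snd, colUpdate_snd_iff] at hflag
  obtain ⟨z, hz, hw⟩ := hflag
  rcases z with i | j'
  · simp only [updWall] at hw
    rw [hP₁flag] at hw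
    exact Bool.false_ne_true hw
  · simp only [updWall] at hw
    have hj' : j' = 0 := Fin.ext hw.2
    subst hj'
    have := (eqvGen_eq_of_isolated hiso₁' hz).2 rfl
    simp only [Sum.inr.injEq] at this
    exact hj this

/-- In a chain of connections of two patterns from a nonzero site to the bottom site, some nonzero
site is directly joined to the bottom site. [folklore] -/
theorem exists_fst_zero_of_eqvGen {Q Q' : ColPattern m} (hQs : ∀ i j, Q.1 i j = true → Q.1 j i = true)
    (hQ's : ∀ i j, Q'.1 i j = true → Q'.1 j i = true) {x y : Fin (m + 1)}
    (h : EqvGen (fun i i' : Fin (m + 1) => Q.1 i i' = true ∨ Q'.1 i i' = true) x y) :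
    (x = 0 ↔ y = 0) ∨ ∃ g : Fin (m + 1), g ≠ 0 ∧ (Q.1 g 0 = true ∨ Q'.1 g 0 = true) := by
  induction h with
  | rel a b hr =>
    by_cases ha : a = 0 <;> by_cases hb : b = 0
    · exact Or.inl (by simp [ha, hb])
    · subst ha; exact Or.inr ⟨b, hb, hr.imp (hQs _ _) (hQ's _ _)⟩
    · subst hb; exact Or.inr ⟨a, ha, hr⟩
    · exact Or.inl (by simp [ha, hb])
  | refl a => exact Or.inl Iff.rfl
  | symm a b _ ih => exact ih.imp Iff.symm id
  | trans a b c _ _ ih₁ ih₂ =>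
    rcases ih₁ with h1 | h1
    · rcases ih₂ with h2 | h2
      · exact Or.inl (h1.trans h2)
      · exact Or.inr h2
    · exact Or.inr h1

/-- **A junction through the wall involves a wall-connected pattern** (width `m ≥ 1`, valid even
patterns). [cite: IkhlefPonsaing2012, §4.1] -/
theorem wallConn_or_of_ipJunction (hm : m ≠ 0) {Q Q' : ColPattern m} (hQ : IsValid 0 Q) (hQ' : IsValid 0 Q')
    (hJ : ipJunction m (Fin.last m) Q Q' = true) : WallConn Q ∨ WallConn Q' := by
  classical
  unfold ipJunction at hJ
  rw [decide_eq_true_eq] at hJ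
  obtain ⟨f, hf, hflag⟩ := hJ
  by_cases hf0 : f = 0
  · subst hf0
    rcases exists_fst_zero_of_eqvGen hQ.symm hQ'.symm hf with h | ⟨g, hg, hg0 | hg0⟩
    · exact absurd (h.2 rfl) (fun h' => hm (by have := congrArg Fin.val h'; simpa using this))
    · exact Or.inl ⟨g, hg, hQ.wall 0 g (hQ.symm _ _ hg0) (hQ.bottom (by decide))⟩
    · exact Or.inr ⟨g, hg, hQ'.wall 0 g (hQ'.symm _ _ hg0) (hQ'.bottom (by decide))⟩
  · rcases hflag with h | h
    · exact Or.inl ⟨f, hf0, h⟩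
    · exact Or.inr ⟨f, hf0, h⟩

/-! ### The level-`1` edges inside the layers -/

/-- `levelOneEdge₀` is a lattice edge of layer `0`. [folklore] -/
theorem levelOneEdge₀_mem : levelOneEdge₀ ∈ latticeLayer m 0 := by
  rw [latticeLayer_eq_image, Finset.mem_image]
  exact ⟨(0, 0), by simp [latticeIdx], rfl⟩

/-- `levelOneEdge₁` is a lattice edge of layer `1`. [folklore] -/
theorem levelOneEdge₁_mem : levelOneEdge₁ ∈ latticeLayer m 1 := by
  rw [latticeLayer_eq_image, Finset.mem_image]
  exact ⟨(0, 0), by simp [latticeIdx], rfl⟩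

/-- In layer `0`, the only lattice edge at the old bottom site is `levelOneEdge₀`. [folklore] -/
theorem edgeFn_zero_bottom {U : Finset (Sym2 (Site 2))} (hU : U ⊆ (latticeLayer m 0).erase levelOneEdge₀) (j : Fin (m + 1)) :
    edgeFn m 0 U 0 j = false := by
  rw [Bool.eq_false_iff, ne_eq, edgeFn, decide_eq_true_eq]
  intro h
  have h' := hU h
  rw [Finset.mem_erase, latticeLayer_eq_image, Finset.mem_image] at h'
  obtain ⟨hne, p, hp, hpe⟩ := h'
  have hinj := mk_colSite_injective (m := m) 0 (a₁ := p) (a₂ := ((0 : Fin (m + 1)), j)) (by simpa using hpe)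
  subst hinj
  simp only [latticeIdx, Finset.mem_filter, Finset.mem_univ, true_and] at hp
  have h0 : (((0 : Fin (m + 1)) : ℕ) : ℤ) = 0 := by simp
  rw [h0] at hp
  have hj : (j : ℕ) = 0 := by rcases hp with hp | hp <;> omega
  have hj' : j = 0 := Fin.ext (by rw [hj]; simp)
  subst hj'
  exact hne rfl

/-- In layer `1`, the only lattice edge at the new bottom site is `levelOneEdge₁`. [folklore] -/
theorem edgeFn_one_bottom {U : Finset (Sym2 (Site 2))} (hU : U ⊆ (latticeLayer m 1).erase levelOneEdge₁) (i : Fin (m + 1)) :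
    edgeFn m 1 U i 0 = false := by
  rw [Bool.eq_false_iff, ne_eq, edgeFn, decide_eq_true_eq]
  intro h
  have h' := hU h
  rw [Finset.mem_erase, latticeLayer_eq_image, Finset.mem_image] at h'
  obtain ⟨hne, p, hp, hpe⟩ := h'
  have hinj := mk_colSite_injective (m := m) 1 (a₁ := p) (a₂ := (i, (0 : Fin (m + 1)))) (by simpa using hpe)
  subst hinj
  simp only [latticeIdx, Finset.mem_filter, Finset.mem_univ, true_and] at hp
  have h0 : (((0 : Fin (m + 1)) : ℕ) : ℤ) = 0 := by simp
  rw [h0] at hp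
  have hi : (i : ℕ) = 0 := by rcases hp with hp | hp <;> omega
  have hi' : i = 0 := Fin.ext (by rw [hi]; simp)
  subst hi'
  exact hne rfl

end TwoStep

end Wiring

end Literature.Probability.Percolation
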